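import Literature.Probability.RandomPlanarGeometry.SAWCountMonotoneUpToFourD
import Literature.Probability.RandomPlanarGeometry.SAWPulledLargeForceExpansionZdTenthOrder
import Literature.Probability.RandomPlanarGeometry.SAWCountZdEleven
import HarnessLib

/-!
# Monotonicity `cₙ ≤ cₙ₊₁` (O'Brien 1990) for all `n ≤ 10`, in EVERY dimension

Sequel of `SAWCountMonotoneUpToFourD.lean` (`cₙ ≤ cₙ₊₁` for `n ≤ 4d`, every `d ≥ 1`): that range covers
`n ≤ 10` as soon as `d ≥ 3`, and `n ≤ 8` for `d = 2`; the two remaining planar instances `c₉ ≤ c₁₀ ≤ c₁₁`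
on `ℤ²` are read off the tree's all-dimension enumerations `WordTypes.count_nine_two`
(`SAWPulledLargeForceExpansionZdTenStep`), `WordTypes.count_ten_two_three` (`…TenthOrder`) and
`WordTypes.count_eleven_two_five` (`SAWCountZdEleven`): `c₉ = 16268`, `c₁₀ = 44100`, `c₁₁ = 120292`
(Madras–Slade Table C.1).  Hence the first range of O'Brien's inequality that is uniform in the dimension:

* `count_le_count_succ_of_le_ten` : **`cₙ ≤ cₙ₊₁` for every `d ≥ 1` and every `n ≤ 10`.**

The general inequality is O'Brien's theorem, the tree's named fact `BDGS2012_count_mono`.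
[cite: MadrasSlade1993, §1.2; Appendix C, Table C.1] [cite: BDGS2012, §1.3 (`cₙ ≤ cₙ₊₁`, O'Brien 1990)]
-/

open Literature.Probability.LatticeModels Literature.Probability.Percolation SimpleGraph

namespace Literature.Probability.RandomPlanarGeometry.SAW.Zd

/-- **`cₙ ≤ cₙ₊₁` for every `n ≤ 10`, in every dimension `d ≥ 1`**: by `count_le_count_succ_of_le_four_mul`
(`n ≤ 4d`) for `d ≥ 3`, and for `d = 2`, `n ≤ 8`; `d = 1` by `count_one_le_count_one_succ`; the planar
`n = 9, 10` by the enumerations `c₉ = 16268 ≤ c₁₀ = 44100 ≤ c₁₁ = 120292`.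
[cite: BDGS2012, §1.3] [cite: MadrasSlade1993, Appendix C, Table C.1] -/
theorem count_le_count_succ_of_le_ten {d n : ℕ} (hd : 1 ≤ d) (hn : n ≤ 10) :
    count d n ≤ count d (n + 1) := by
  rcases Nat.lt_or_ge d 3 with hd3 | hd3
  · obtain rfl | rfl : d = 1 ∨ d = 2 := by omega
    · exact count_one_le_count_one_succ n
    · rcases Nat.lt_or_ge n 9 with hn9 | hn9
      · exact count_le_count_succ_of_le_four_mul hd (by omega)
      · obtain rfl | rfl : n = 9 ∨ n = 10 := by omega
        · rw [WordTypes.count_nine_two, WordTypes.count_ten_two_three.1]; norm_num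
        · rw [WordTypes.count_ten_two_three.1, WordTypes.count_eleven_two_five.1]; norm_num
  · exact count_le_count_succ_of_le_four_mul hd (by omega)

end Literature.Probability.RandomPlanarGeometry.SAW.Zd
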